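import Mathlib.Analysis.SpecialFunctions.Pow.Real
import Mathlib.Analysis.SpecialFunctions.Sqrt
import Mathlib.Tactic.NormNum
import Mathlib.Tactic.Linarith
import Mathlib.Tactic.Positivity
import Mathlib.Tactic.FieldSimp
import Mathlib.Tactic.FinCases
import HarnessLib

/-!
# Volkov's Monte-Carlo sampling densities for the AMM integrands — the printed parameter sets of PRD 98 (2018) and PRD 110 (2024) and the printed smooth-max functions `μ`, `τ`, typed verbatim, with kernel facts (mixture weights sum to one; `μ`, `τ` exceed the maxima they approximate by at most `1/2` resp. `(C_a+C_s)/4`; `C_Add + C_Sat > 0` in every column of Table V; the second stabilisation exponent is the constant `1` whenever `Deg₀ ≤ 4`)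

independent recomputation; certified where stated, statistical where stated; no new-physics claim.

CITATION HEADER (venture `QEDPrecision`, cell `pub-qed`; literature seat gen 21; VALUE-FREE: SAMPLER PARAMETERS ONLY — these numbers define
probability densities used for importance sampling; none is a physics value; nothing per graph / per family). For the cell's IR/SE lane
(`irse/SEATS.md` strands (b)/(c): "diff §IV B [of PRD 110] against PRD 98 §IV line by line"; int-2's sampler `volkov2018` = PRD 98 §III–IV).
Sources (LaTeX e-prints held by the cell under HOME `data/lit/sources/.cache/<arXiv id>/`):
* [Volkov2024] S. Volkov, "Calculation of the total 10th order QED contribution to the electron magnetic moment", Phys. Rev. D 110, 036001 (2024)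
  = arXiv:2404.00649v2, §IV.A "General idea" (tex `amm5_a1_all.tex` l.454–517; arXiv-PDF p.9:L10 – p.10:L17). VERBATIM: "For the integration we
  use the predefined probability density functions of the form g(z) = C_main × g₀(z) + C_min × g_min(z) + C_uniform × g_uniform(z) + C_modify ×
  (1/N) Σ_{i=1}^{N} g_i(z), where … C_main, C_min, C_uniform, C_modify are arbitrary nonnegative numbers, C_main + C_min + C_uniform + C_modify = 1;
  N is an arbitrary natural number. The function g₀ has the form g₀(z) = C × ∏_{l=2}^{K} (z_{j_l}/z_{j_{l−1}})^{Deg₀({j_l, j_{l+1}, …, j_K})} /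
  (z₁z₂…z_K), where (j₁,…,j_K) is a permutation of 1,…,K such that z_{j₁} ≥ z_{j₂} ≥ … ≥ z_{j_K} (this splitting of the integration area is
  called the Hepp sectors); Deg₀(s) are arbitrary positive real numbers defined for any set s ⊆ {1,2,…,K} (except the empty and full sets); C is
  a constant such that ∫ g₀ δ(…) = 1. … The functions g_i, 1 ≤ i ≤ N, and g_min have the same form as g₀, but with the numbers Deg_i(s) and
  Deg_min(s) instead of Deg₀(s) (and with different C). We use Deg_i(s) = max(S^sat_i, S^mul_i Deg₀(s) − S^sub_i), Deg_min(s) = D, where D,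
  S^sat_i, S^mul_i, S^sub_i (1 ≤ i ≤ N) are arbitrary positive real numbers. The function g_uniform corresponds to the uniform distribution
  (constant). We use the following constant values: C_min = 0.002, C_uniform = 0.06, C_modify = 0.02, C_main = 1 − C_min − C_uniform −
  C_modify = 0.918, D = 0.75, N = 2, S^sat_1 = 0.6, S^mul_1 = 1.0, S^sub_1 = 1.3, S^sat_2 = 1.0, S^mul_2 = 0.4, S^sub_2 = 0.6." (PDF p10:L8–L10)
  "The function g₀(z) is designed in such a way to be "near" to C|I(z)|. The remaining terms of g(z) are stabilization terms; they prevent from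
  significant underestimation of |I(z)|, which can lead to poor Monte Carlo convergence. The choice of S^sat_i, S^mul_i, S^sub_i is the result
  of experiments after the discovery of poor convergence for some Feynman graphs from Set I(i)." — §IV.B.3 "The formula" (tex l.1149–1177; PDF
  p.21:L19–L55): "Deg₀(s) = C_BigZ + (C_BigF − C_BigZ)·|Photon(s)|/|Photon(Edge[G])|, if Lepton(Edge[G]) ⊆ s, and there exists F ∈ 𝔉_max[G] such
  that ω̃_{G′,F}(s) ≥ 0 for all G′ ∈ F; min_{F∈𝔉_max[G]} D_F(s) otherwise, where D_F(s) = τ(−Σ_{G′∈F} ω̃′_{G′,F}(s), C_Add(s), C_Sat(s)),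
  C_BigZ, C_BigF, C_Add(s), C_Sat(s) are taken from Table V, τ(x, C_a, C_s) = ½(C_a + C_s) × μ((x − C_s)/(C_a + C_s)), μ(t) = 2 + t +
  √(t² + 0.25). Here, the table constants were determined by numerical experiments with the Monte Carlo convergence speed at the 4-loop level;
  μ(t) is a smooth approximation for 2 + max(0, 2t); the function τ(x, C_a, C_s) is a smooth approximation for max(x, C_s) + C_a." — TABLE V
  (tex l.1033–1049; PDF p.19:L60–L73), caption "The constants that are used for obtaining Deg₀(s). The values depend on whether s is
  cyclo-complete in the whole graph G and whether the external photon of G is incident to v ∈ LPath[G] ("on path") or not ("on loop").",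
  columns (cyclo-complete: on path, on loop; not cyclo-complete: on path, on loop), rows VERBATIM: C_SubLSEOP(s) 0 0 0.293 0 · C_SubLSEOL(s)
  0.021 0 0 0 · C_SubI(s) 0 0.011 0.228 0.622 · C_SubVOP(s) 0.085 0 0.041 0.394 · C_SubVOL(s) 0.185 0 0 0 · C_BigZ 0.695 1.079 … … ·
  C_BigF 0.285 0.38 … … · C_Add(s) 0.199 −0.122 0 0.187 · C_Sat(s) 0.46 0.716 0.785 0.684 (the two "…" cells are printed as such: C_BigZ /
  C_BigF are used only for cyclo-complete s). §IV.B.3 worked example (tex l.1199–1205): "If s = {1,…,8,10} … Deg₀(s) = ¼ C_BigF + ¾ C_BigZ."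
* [Volkov2018] S. Volkov, Phys. Rev. D 98, 076018 (2018) = arXiv:1807.05281v2, §III "PROBABILITY DENSITY FUNCTIONS FOR MONTE CARLO INTEGRATION"
  (tex `amm4gpu_arxiv.tex` l.484–648) — the 2018 density g₀ (eq. `eq_density_0`: the same Hepp-sector product with exponents Deg(s)) with
  "Deg(s) = C_bigZ + (C_bigF − C_bigZ) N_L(s)/N_L(G), if s contain all electron lines of G; C_add + min_{F∈𝔉_max[G]} Σ_{G′∈F} max(0, −ω*_{G′/F}(s) −
  C_sub[G′]) otherwise, where C_sub[G′] = C_subI if G′ ∈ 𝕴[G], C_subSE if G′ is a self-energy subgraph, C_subO in the other cases. … For good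
  Monte Carlo convergence we can use the values" (eq. `eq_mc_constants`, tex l.636–641; corpus chunk p0008:L23) "C_bigZ = 0.256, C_bigF = 0.839,
  C_add = 0.786, C_subI = 0.2, C_subSE = 0, C_subO = 0.2. These values were obtained by a series of numerical experiments on 4-loop Feynman
  graphs."; §IV.E "Modified probability density functions" (tex l.1006–1043; chunk p0011:L110): "g(z) = C₁g₁(z) + C₂g₂(z) + C₃g₃(z) + C₄g₄(z) …
  g₃ is defined by (eq_density_0), (eq_density), but with same Deg(s) = D, g₄(z) = (n−1)! (the uniform distribution) … All computations are
  performed with the following values for the constants: D = 0.75, C₂ = 0.03, C₃ = 0.035, C₄ = 0.035, C₁ = 1 − C₂ − C₃ − C₄." (The cell's sampler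
  `volkov2018` implements this paper's §III–IV: HOME `pub-qed-int-2/SCHEME-NOTES.md` C6.)

What is typed, and what the kernel certifies (`norm_num` / `ring` / elementary real analysis on the PRINTED parameters and formulas only):
* `W24`, `W18` — the printed mixture weights; `W24_sum`, `W18_sum`: each set sums to 1 exactly, as the printed constraint / definition says
  (0.918 + 0.002 + 0.06 + 0.02 = 1; 1 − 0.03 − 0.035 − 0.035 = 0.9 > 0), and all weights are nonnegative.
* `deg24 i d0` — the printed Deg_i(s) = max(S^sat_i, S^mul_i Deg₀(s) − S^sub_i) with the printed S-constants (N = 2); `deg24_two_eq_one`: for every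
  Deg₀(s) ≤ 4 the second stabilisation exponent is the constant 1 (0.4·Deg₀ − 0.6 ≤ 1), i.e. on such sets g₂ is a fixed-exponent density like
  g_min (exponent D = 0.75) but with exponent 1; `deg24_one_eq_sat`: Deg₁(s) = 0.6 whenever Deg₀(s) ≤ 1.9; `degMin24`, `degMin18`: D = 0.75 in
  both vintages (`D_2018_eq_D_2024`).
* `mu`, `tau` — the printed smooth-max functions; `mu_sub_bounds`: 0 < μ(t) − (2 + max(0, 2t)) ≤ 1/2 for every real t; `tau_sub_bounds`: for
  C_a + C_s > 0, 0 < τ(x, C_a, C_s) − (max(x, C_s) + C_a) ≤ (C_a + C_s)/4 — the printed "smooth approximation" sentences made quantitative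
  (τ always lies ABOVE the sharp expression, by at most a quarter of C_a + C_s, with equality of the bound at x = C_s: `tau_at_Cs`).
* `tableV` — TABLE V verbatim (the two "…" cells as `none`); `tableV_CaCs_pos`: C_Add(s) + C_Sat(s) > 0 in all four columns (0.659, 0.594,
  0.785, 0.871) — so τ's hypothesis holds column by column even where C_Add is negative; `tableV_CaCs_quarter_le`: the τ-overshoot bound
  (C_Add + C_Sat)/4 is at most 0.21775 (not-cyclo-complete / on-loop column); `tableV_nonneg_except_CAdd`: every printed constant other than
  C_Add(cyclo-complete, on loop) = −0.122 is ≥ 0 ("Since all the constants C_SubLSEOP, …, C_SubVOL are nonnegative", tex l.1188).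
* `deg0_topcase_quarter`: the printed worked example "Deg₀(s) = ¼ C_BigF + ¾ C_BigZ" is the top case of the formula at photon fraction 1/4 (ring).
* `K18`, the 2018 constants verbatim; `vintage_diff` (docstring table, not a kernel statement): 2018 → 2024 the exponent formula changed from
  "C_add + min_F Σ max(0, −ω* − C_sub)" with three C_sub constants to "min_F τ(−Σ ω̃′, C_Add(s), C_Sat(s))" with five set-dependent C_Sub rows,
  a smooth max and a saturation constant; the top case changed from the LOOP fraction N_L(s)/N_L(G) to the PHOTON fraction; the stabilisation
  mixture changed from (g₁, g₂ = exponent-weighted sectors, g₃ = D, g₄ = uniform) with (0.9, 0.03, 0.035, 0.035) to (g₀, g_min = D, g_uniform,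
  ½(g₁ + g₂) modified-exponent) with (0.918, 0.002, 0.06, 0.02).
NOT claimed: anything about the variance or convergence of the resulting estimators (PRD 110 §IV.B.1: "we can not guarantee this for all orders;
moreover, examples of high order are known that result in an infinite integral"), nor any graph-dependent quantity (ω̃, forests, I-closures).
-/

namespace Literature.MathematicalPhysics.QuantumFieldTheory.Volkov2024

noncomputable section

/-! ## PRD 110 (2024) §IV.A — mixture weights and stabilisation exponents -/

/-- The printed mixture weights of PRD 110 §IV.A: (C_main, C_min, C_uniform, C_modify) = (0.918, 0.002, 0.06, 0.02).
[cite: Volkov2024, §IV.A, constants display (PDF p.10)] -/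
def W24 : ℚ × ℚ × ℚ × ℚ := (0.918, 0.002, 0.06, 0.02)

/-- "C_main + C_min + C_uniform + C_modify = 1" holds for the printed values, exactly; all four are nonnegative ("arbitrary nonnegative numbers").
[cite: Volkov2024, §IV.A] -/
theorem W24_sum : W24.1 + W24.2.1 + W24.2.2.1 + W24.2.2.2 = 1 ∧
    0 ≤ W24.1 ∧ 0 ≤ W24.2.1 ∧ 0 ≤ W24.2.2.1 ∧ 0 ≤ W24.2.2.2 := by norm_num [W24]

/-- "C_main = 1 − C_min − C_uniform − C_modify = 0.918" — the printed subtraction is exact. [cite: Volkov2024, §IV.A] -/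
theorem W24_main_def : (1 : ℚ) - 0.002 - 0.06 - 0.02 = 0.918 := by norm_num

/-- `D = 0.75` (the exponent of g_min) and `N = 2` (number of modified densities), PRD 110 §IV.A. [cite: Volkov2024, §IV.A] -/
def degMin24 : ℚ := 0.75

/-- `N = 2`. [cite: Volkov2024, §IV.A] -/
def N24 : ℕ := 2

/-- The printed stabilisation constants (S^sat_i, S^mul_i, S^sub_i), i = 1, 2: (0.6, 1.0, 1.3) and (1.0, 0.4, 0.6).
[cite: Volkov2024, §IV.A, constants display (PDF p.10)] -/
def S24 : Fin 2 → ℚ × ℚ × ℚ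
  | 0 => (0.6, 1.0, 1.3)
  | 1 => (1.0, 0.4, 0.6)

/-- "Deg_i(s) = max(S^sat_i, S^mul_i Deg₀(s) − S^sub_i)" with the printed constants, as a function of `d0 = Deg₀(s)`.
[cite: Volkov2024, §IV.A] -/
def deg24 (i : Fin 2) (d0 : ℚ) : ℚ := max (S24 i).1 ((S24 i).2.1 * d0 - (S24 i).2.2)

/-- Deg₁ with the printed constants: max(0.6, 1.0·Deg₀ − 1.3). [cite: Volkov2024, §IV.A] -/
theorem deg24_one_def (d0 : ℚ) : deg24 0 d0 = max 0.6 (1.0 * d0 - 1.3) := rfl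

/-- Deg₂ with the printed constants: max(1.0, 0.4·Deg₀ − 0.6). [cite: Volkov2024, §IV.A] -/
theorem deg24_two_def (d0 : ℚ) : deg24 1 d0 = max 1.0 (0.4 * d0 - 0.6) := rfl

/-- For every set with Deg₀(s) ≤ 4 the SECOND modified exponent is the constant 1: Deg₂(s) = max(1.0, 0.4·Deg₀(s) − 0.6) = 1.
[cite: Volkov2024, §IV.A] -/
theorem deg24_two_eq_one (d0 : ℚ) (h : d0 ≤ 4) : deg24 1 d0 = 1 := by
  rw [deg24_two_def, max_eq_left]
  · norm_num
  · linarith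

/-- For every set with Deg₀(s) ≤ 1.9 the FIRST modified exponent is the saturation value 0.6: Deg₁(s) = max(0.6, Deg₀(s) − 1.3) = 0.6; from 1.9 on
it is Deg₀(s) − 1.3. [cite: Volkov2024, §IV.A] -/
theorem deg24_one_eq (d0 : ℚ) : (d0 ≤ 1.9 → deg24 0 d0 = 0.6) ∧ (1.9 ≤ d0 → deg24 0 d0 = d0 - 1.3) := by
  rw [deg24_one_def]
  constructor
  · intro h
    rw [max_eq_left]
    linarith
  · intro h
    rw [max_eq_right]
    · norm_num
    · linarith

/-! ## PRD 110 (2024) §IV.B.3 — the smooth maxima `μ`, `τ` -/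

/-- "μ(t) = 2 + t + √(t² + 0.25)" — "a smooth approximation for 2 + max(0, 2t)". [cite: Volkov2024, §IV.B.3 "The formula" (PDF p.21)] -/
def mu (t : ℝ) : ℝ := 2 + t + Real.sqrt (t ^ 2 + 1 / 4)

/-- "τ(x, C_a, C_s) = ½(C_a + C_s) × μ((x − C_s)/(C_a + C_s))" — "a smooth approximation for max(x, C_s) + C_a".
[cite: Volkov2024, §IV.B.3 "The formula" (PDF p.21)] -/
def tau (x ca cs : ℝ) : ℝ := (1 / 2) * (ca + cs) * mu ((x - cs) / (ca + cs))

/-- `√(t² + 1/4) − |t| ∈ (0, 1/2]` — the elementary estimate behind both bounds. [cite: Volkov2024, §IV.B.3] -/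
theorem sqrt_sq_add_quarter_bounds (t : ℝ) :
    |t| < Real.sqrt (t ^ 2 + 1 / 4) ∧ Real.sqrt (t ^ 2 + 1 / 4) ≤ |t| + 1 / 2 := by
  constructor
  · have h1 : Real.sqrt (t ^ 2) = |t| := Real.sqrt_sq_eq_abs t
    rw [← h1]
    exact Real.sqrt_lt_sqrt (sq_nonneg t) (by linarith)
  · have h2 : Real.sqrt ((|t| + 1 / 2) ^ 2) = |t| + 1 / 2 := Real.sqrt_sq (by positivity)
    rw [← h2]
    apply Real.sqrt_le_sqrt
    have h3 : (|t| + 1 / 2) ^ 2 = t ^ 2 + |t| + 1 / 4 := by rw [add_sq, sq_abs]; ring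
    rw [h3]
    have := abs_nonneg t
    linarith

/-- The printed sentence "μ(t) is a smooth approximation for 2 + max(0, 2t)", quantified: 0 < μ(t) − (2 + max(0, 2t)) ≤ 1/2 for every real t.
[cite: Volkov2024, §IV.B.3 "The formula"] -/
theorem mu_sub_bounds (t : ℝ) : 0 < mu t - (2 + max 0 (2 * t)) ∧ mu t - (2 + max 0 (2 * t)) ≤ 1 / 2 := by
  obtain ⟨hl, hu⟩ := sqrt_sq_add_quarter_bounds t
  unfold mu
  rcases le_or_gt 0 t with ht | ht
  · rw [abs_of_nonneg ht] at hl hu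
    rw [max_eq_right (by linarith : (0:ℝ) ≤ 2 * t)]
    constructor <;> linarith
  · rw [abs_of_neg ht] at hl hu
    rw [max_eq_left (by linarith : 2 * t ≤ (0:ℝ))]
    constructor <;> linarith

/-- The printed sentence "τ(x, C_a, C_s) is a smooth approximation for max(x, C_s) + C_a", quantified: whenever C_a + C_s > 0 (true in every
column of Table V, `tableV_CaCs_pos`), 0 < τ(x, C_a, C_s) − (max(x, C_s) + C_a) ≤ (C_a + C_s)/4. [cite: Volkov2024, §IV.B.3 "The formula"] -/
theorem tau_sub_bounds (x ca cs : ℝ) (h : 0 < ca + cs) :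
    0 < tau x ca cs - (max x cs + ca) ∧ tau x ca cs - (max x cs + ca) ≤ (ca + cs) / 4 := by
  obtain ⟨hl, hu⟩ := mu_sub_bounds ((x - cs) / (ca + cs))
  have key : tau x ca cs - (max x cs + ca) = (1 / 2) * (ca + cs) * (mu ((x - cs) / (ca + cs)) - (2 + max 0 (2 * ((x - cs) / (ca + cs))))) := by
    have hmax : max 0 (2 * ((x - cs) / (ca + cs))) = 2 * (max x cs - cs) / (ca + cs) := by
      rcases le_or_gt cs x with hx | hx
      · rw [max_eq_left hx, max_eq_right]
        · ring
        · apply mul_nonneg (by norm_num); exact div_nonneg (by linarith) h.le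
      · rw [max_eq_right hx.le, max_eq_left]
        · simp
        · have : (x - cs) / (ca + cs) < 0 := div_neg_of_neg_of_pos (by linarith) h
          linarith
    have hne : ca + cs ≠ 0 := ne_of_gt h
    rw [hmax]; unfold tau; field_simp; ring
  rw [key]
  constructor
  · exact mul_pos (mul_pos (by norm_num) h) hl
  · nlinarith [mul_le_mul_of_nonneg_left hu h.le]

/-- At x = C_s the overshoot bound is attained: τ(C_s, C_a, C_s) = C_s + C_a + (C_a + C_s)/4. [cite: Volkov2024, §IV.B.3 "The formula"] -/
theorem tau_at_Cs (ca cs : ℝ) : tau cs ca cs = cs + ca + (ca + cs) / 4 := by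
  unfold tau mu
  have h0 : (cs - cs) / (ca + cs) = 0 := by simp
  rw [h0]
  have hs : Real.sqrt ((0:ℝ) ^ 2 + 1 / 4) = 1 / 2 := by
    rw [show ((0:ℝ) ^ 2 + 1 / 4) = (1 / 2) ^ 2 by norm_num]
    exact Real.sqrt_sq (by norm_num)
  rw [hs]; ring

/-! ## PRD 110 (2024) TABLE V — the constants for Deg₀(s) -/

/-- One row of TABLE V: the constant's name and its four printed cells (cyclo-complete: on path, on loop; not cyclo-complete: on path, on loop);
a cell printed "…" is `none`. [cite: Volkov2024, Table V (PDF p.19)] -/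
structure TableVRow where
  /-- printed constant name -/
  name : String
  /-- cyclo-complete, on path -/
  ccPath : Option ℚ
  /-- cyclo-complete, on loop -/
  ccLoop : Option ℚ
  /-- not cyclo-complete, on path -/
  ncPath : Option ℚ
  /-- not cyclo-complete, on loop -/
  ncLoop : Option ℚ

/-- TABLE V of PRD 110, 036001, VERBATIM (nine rows). [cite: Volkov2024, Table V (PDF p.19:L60–L73; tex l.1033–1049)] -/
def tableV : List TableVRow :=
  [ ⟨"C_SubLSEOP(s)", some 0,     some 0,        some 0.293, some 0⟩,
    ⟨"C_SubLSEOL(s)", some 0.021, some 0,        some 0,     some 0⟩,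
    ⟨"C_SubI(s)",     some 0,     some 0.011,    some 0.228, some 0.622⟩,
    ⟨"C_SubVOP(s)",   some 0.085, some 0,        some 0.041, some 0.394⟩,
    ⟨"C_SubVOL(s)",   some 0.185, some 0,        some 0,     some 0⟩,
    ⟨"C_BigZ",        some 0.695, some 1.079,    none,       none⟩,
    ⟨"C_BigF",        some 0.285, some 0.38,     none,       none⟩,
    ⟨"C_Add(s)",      some 0.199, some (-0.122), some 0,     some 0.187⟩,
    ⟨"C_Sat(s)",      some 0.46,  some 0.716,    some 0.785, some 0.684⟩ ]

/-- The C_Add(s) row of TABLE V by column (0 = cyclo-complete/on path, 1 = cyclo-complete/on loop, 2 = not c.-c./on path, 3 = not c.-c./on loop).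
[cite: Volkov2024, Table V] -/
def cAdd : Fin 4 → ℚ
  | 0 => 0.199
  | 1 => -0.122
  | 2 => 0
  | 3 => 0.187

/-- The C_Sat(s) row of TABLE V by column. [cite: Volkov2024, Table V] -/
def cSat : Fin 4 → ℚ
  | 0 => 0.46
  | 1 => 0.716
  | 2 => 0.785
  | 3 => 0.684

/-- `cAdd`, `cSat` are the last two rows of `tableV`. [cite: Volkov2024, Table V] -/
theorem cAdd_cSat_rows :
    (tableV.map fun r => (r.ccPath, r.ccLoop, r.ncPath, r.ncLoop)).drop 7 =
      [(some (cAdd 0), some (cAdd 1), some (cAdd 2), some (cAdd 3)), (some (cSat 0), some (cSat 1), some (cSat 2), some (cSat 3))] := by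
  rfl

/-- C_Add(s) + C_Sat(s) > 0 in every column of TABLE V (0.659, 0.594, 0.785, 0.871) — the hypothesis of `tau_sub_bounds` holds column by column,
including the column where C_Add(s) = −0.122 < 0. [cite: Volkov2024, Table V and §IV.B.3] -/
theorem tableV_CaCs_pos : ∀ j : Fin 4, 0 < cAdd j + cSat j := by
  intro j; fin_cases j <;> simp only [cAdd, cSat] <;> norm_num

/-- The τ-overshoot bound (C_Add + C_Sat)/4 per column is at most 0.21775 (reached in the not-cyclo-complete / on-loop column).
[cite: Volkov2024, Table V and §IV.B.3] -/
theorem tableV_CaCs_quarter_le : ∀ j : Fin 4, (cAdd j + cSat j) / 4 ≤ 0.21775 := by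
  intro j; fin_cases j <;> simp only [cAdd, cSat] <;> norm_num

/-- Every printed cell of TABLE V other than C_Add(cyclo-complete, on loop) = −0.122 is ≥ 0 (tex l.1188: "Since all the constants C_SubLSEOP,
C_SubLSEOL, C_SubI, C_SubVOP, C_SubVOL are nonnegative"). [cite: Volkov2024, Table V] -/
theorem tableV_nonneg_except_cAdd_ccLoop :
    ((tableV.flatMap fun r => [r.ccPath, r.ccLoop, r.ncPath, r.ncLoop]).filterMap id).filter (fun q => decide (q < 0)) = [-0.122] := by
  decide +kernel

/-- The top case of the 2024 formula, "Deg₀(s) = C_BigZ + (C_BigF − C_BigZ)·|Photon(s)|/|Photon(Edge[G])|", at photon fraction 1/4 is the printed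
worked-example value "¼ C_BigF + ¾ C_BigZ" (tex l.1205). [cite: Volkov2024, §IV.B.3 worked example] -/
theorem deg0_topcase_quarter (cBigZ cBigF : ℚ) : cBigZ + (cBigF - cBigZ) * (1 / 4) = (1 / 4) * cBigF + (3 / 4) * cBigZ := by ring

/-! ## PRD 98 (2018) §III–IV — the earlier parameter set -/

/-- The 2018 constants of eq. `eq_mc_constants`: (C_bigZ, C_bigF, C_add, C_subI, C_subSE, C_subO) = (0.256, 0.839, 0.786, 0.2, 0, 0.2).
[cite: Volkov2018, §III eq. (eq_mc_constants)] -/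
def K18 : ℚ × ℚ × ℚ × ℚ × ℚ × ℚ := (0.256, 0.839, 0.786, 0.2, 0, 0.2)

/-- The 2018 modified-density weights of §IV.E: (C₁, C₂, C₃, C₄) with "C₁ = 1 − C₂ − C₃ − C₄", C₂ = 0.03, C₃ = 0.035, C₄ = 0.035, and D = 0.75.
[cite: Volkov2018, §IV.E "Modified probability density functions"] -/
def W18 : ℚ × ℚ × ℚ × ℚ := (1 - 0.03 - 0.035 - 0.035, 0.03, 0.035, 0.035)

/-- `D = 0.75` in 2018 as well. [cite: Volkov2018, §IV.E] -/
def degMin18 : ℚ := 0.75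

/-- The 2018 weights sum to 1, C₁ = 0.9, all nonnegative. [cite: Volkov2018, §IV.E] -/
theorem W18_sum : W18.1 + W18.2.1 + W18.2.2.1 + W18.2.2.2 = 1 ∧ W18.1 = 0.9 ∧
    0 ≤ W18.1 ∧ 0 ≤ W18.2.1 ∧ 0 ≤ W18.2.2.1 ∧ 0 ≤ W18.2.2.2 := by norm_num [W18]

/-- The fixed stabilisation exponent D is the same printed number in both vintages. [cite: Volkov2018, §IV.E; Volkov2024, §IV.A] -/
theorem D_2018_eq_D_2024 : degMin18 = degMin24 := by rfl

/-- Printed-constant comparison 2018 → 2024: the MAIN-density weight rose from C₁ = 0.9 to C_main = 0.918, the uniform admixture rose from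
C₄ = 0.035 to C_uniform = 0.06, the fixed-exponent (D = 0.75) admixture fell from C₃ = 0.035 to C_min = 0.002 (arithmetic of the printed
constants only; the remaining components — g₂ of 2018, the modified g₁, g₂ of 2024 — are different functions and are not compared).
[cite: Volkov2018, §IV.E; Volkov2024, §IV.A] -/
theorem weights_2018_vs_2024 :
    W18.1 < W24.1 ∧ W18.2.2.2 < W24.2.2.1 ∧ W24.2.1 < W18.2.2.1 := by norm_num [W18, W24]

/-- The 2018 top-case exponent "C_bigZ + (C_bigF − C_bigZ) N_L(s)/N_L(G)" runs from C_bigZ = 0.256 (no loop of s) to C_bigF = 0.839 (all loops) —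
INCREASING in the loop fraction; the 2024 cyclo-complete/on-path column runs from C_BigZ = 0.695 to C_BigF = 0.285 — DECREASING in the photon
fraction (printed numbers only; the interpolating variables differ: loops in 2018, photons in 2024). [cite: Volkov2018, §III; Volkov2024, Table V] -/
theorem topcase_monotonicity_flipped : K18.1 < K18.2.1 ∧ (0.285 : ℚ) < 0.695 := by norm_num [K18]

end

end Literature.MathematicalPhysics.QuantumFieldTheory.Volkov2024
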